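import Summits.Ventures.CertifiedArithmetic.LowPrec.OptTreeMixed
import Summits.Ventures.CertifiedArithmetic.LowPrec.OptTreePairwise

/-!
# OptTreeMixedDesign — Theorem T5(c,d): two-level designs, product formula, pairwise∘pairwise optimality

HONEST FRAMING: certified error envelopes and provably optimal rounding/accumulation schemes for
low-precision formats under stated cost models; every table by two implementations; no hardware or
vendor claims.

Cost model CM-B (blocked / two-level accumulation) with the exact objective of Theorem T5
(`LowPrec/OptTreeMixed.lean`: worst-case relative under-estimation of a well-formed precision-labelled
tree = `1 - 1/M_t`, `M_t` the node-weighted tree polynomial).  A TWO-LEVEL DESIGN (`DTree`) is an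
outer binary tree whose leaves are blocks (arbitrary labelled trees) and whose internal additions are
all rounded at one wide precision `phi`; `toPTree` is the labelled tree it denotes.

* `treeMP_toPTree` — the node-weighted polynomial of a design is the WEIGHTED outer polynomial
  (`outerW`: leaf weight = block polynomial, `comb v x y = max x y + v·min x y` at the wide nodes).
* `treeMP_uniform` — **product formula (T5(c))**: with the same block `s` everywhere,
  `M = M_s · M_o(v)` (`M_o` the plain tree polynomial of the outer shape).
* `outerLB_le` — **pairwise blocks are optimal inside any outer tree**: replacing every narrow block
  (all additions at precision `plo`, `b_i` leaves) by its Theorem-P lower bound `B_{b_i}(u_lo)` bounds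
  the design polynomial from below (monotonicity of `comb`), with equality for pairwise blocks.
* `product_lower_bound` — **T5(d)**: every design with `m` narrow blocks of `b` leaves each has
  `M ≥ B_b(u_lo) · B_m(v)`, and `pairwise_design_attains` — pairwise blocks in a pairwise outer tree
  attain it: among all two-level designs with `m` blocks of `b` summands (i.e. at a fixed budget of
  `m - 1` wide additions and equal blocks) PAIRWISE∘PAIRWISE IS EXACTLY OPTIMAL, value
  `1 - 1/(B_b(u_lo) B_m(u_hi))`.  (Unequal block sizes at a fixed budget: the exact optimum is the finite
  minimisation of `outerLB` = certificate C16, where most-equal blocks are NOT always optimal.)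
* `WF_toPTree` — designs whose blocks are well formed below `phi` are well formed (so T5 applies).
* `R4_TwoLevelPairwiseOptimal` (+ `_holds`) — Statement-style summary.
-/

namespace Summit.Ventures.CertifiedArithmetic.LowPrec.Opt

open Literature.ComputerArithmetic.JeannerodRump2018

namespace PTree

/-- Number of leaves (summands) of a labelled tree. -/
def nleaves (t : PTree) : ℕ := (SumTree.leaves (forget t)).length

/-- All additions of `t` are rounded at precision `p`. -/
def AllLabels (p : ℕ) : PTree → Prop
  | leaf _ => True
  | node q l r => q = p ∧ AllLabels p l ∧ AllLabels p r

/-- Relabel a plain tree with precision `p` at every addition. -/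
def ofSum (p : ℕ) : SumTree → PTree
  | .leaf x => leaf x
  | .node l r => node p (ofSum p l) (ofSum p r)

/-- A single-precision block's node-weighted polynomial is the plain tree polynomial at `u_p`. -/
theorem treeMP_allLabels (u : ℕ → ℚ) {p : ℕ} : ∀ {t : PTree}, AllLabels p t → treeMP u t = treeM (u p) (forget t)
  | leaf _, _ => rfl
  | node q l r, h => by
      obtain ⟨rfl, hl, hr⟩ := h
      simp [treeMP, forget, treeMP_allLabels u hl, treeMP_allLabels u hr]

/-- `ofSum p t` has all labels `p`. -/
theorem allLabels_ofSum (p : ℕ) : ∀ t : SumTree, AllLabels p (ofSum p t)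
  | .leaf _ => trivial
  | .node l r => ⟨rfl, allLabels_ofSum p l, allLabels_ofSum p r⟩

/-- Forgetting the labels of `ofSum p t` gives back `t`. -/
theorem forget_ofSum (p : ℕ) : ∀ t : SumTree, forget (ofSum p t) = t
  | .leaf _ => rfl
  | .node l r => by simp [forget, ofSum, forget_ofSum p l, forget_ofSum p r]

/-- `M(ofSum p t) = M_t(u_p)`. -/
theorem treeMP_ofSum (u : ℕ → ℚ) (p : ℕ) (t : SumTree) : treeMP u (ofSum p t) = treeM (u p) t := by
  rw [treeMP_allLabels u (allLabels_ofSum p t), forget_ofSum]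

/-- `nleaves (ofSum p t) = |leaves t|`. -/
theorem nleaves_ofSum (p : ℕ) (t : SumTree) : nleaves (ofSum p t) = (SumTree.leaves t).length := by
  simp [nleaves, forget_ofSum]

end PTree

open PTree

/-- The combining form of the tree polynomial at a node of weight `v`. -/
def comb (v x y : ℚ) : ℚ := max x y + v * min x y

/-- `comb` is monotone in both arguments for `v ≥ 0`. -/
theorem comb_mono {v x y X Y : ℚ} (hv : 0 ≤ v) (hx : x ≤ X) (hy : y ≤ Y) : comb v x y ≤ comb v X Y := by
  unfold comb
  have h1 : max x y ≤ max X Y := max_le_max hx hy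
  have h2 : min x y ≤ min X Y := min_le_min hx hy
  nlinarith [mul_le_mul_of_nonneg_left h2 hv]

/-- `comb` is positively homogeneous. -/
theorem comb_mul {v w x y : ℚ} (hw : 0 ≤ w) : comb v (w * x) (w * y) = w * comb v x y := by
  unfold comb
  rcases le_total x y with h | h
  · have h' : w * x ≤ w * y := mul_le_mul_of_nonneg_left h hw
    rw [max_eq_right h', min_eq_left h', max_eq_right h, min_eq_left h]; ring
  · have h' : w * y ≤ w * x := mul_le_mul_of_nonneg_left h hw
    rw [max_eq_left h', min_eq_right h', max_eq_left h, min_eq_right h]; ring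

/-- Two-level design: an outer binary tree of wide additions whose leaves are blocks (labelled trees). -/
inductive DTree : Type
  | blk : PTree → DTree
  | node : DTree → DTree → DTree

namespace DTree

/-- The labelled tree denoted by a design whose wide additions have precision `phi`. -/
def toPTree (phi : ℕ) : DTree → PTree
  | blk b => b
  | node l r => PTree.node phi (toPTree phi l) (toPTree phi r)

/-- The outer shape (blocks become leaves). -/
def shape : DTree → SumTree
  | blk _ => .leaf 0
  | node l r => .node (shape l) (shape r)

/-- Number of blocks. -/
def nblocks (d : DTree) : ℕ := (SumTree.leaves (shape d)).length

/-- Every block satisfies `Q`. -/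
def Blocks (Q : PTree → Prop) : DTree → Prop
  | blk b => Q b
  | node l r => Blocks Q l ∧ Blocks Q r

/-- Weighted outer polynomial: block polynomials at the leaves, `comb v` at the wide nodes. -/
def outerW (u : ℕ → ℚ) (v : ℚ) : DTree → ℚ
  | blk b => treeMP u b
  | node l r => comb v (outerW u v l) (outerW u v r)

/-- Outer polynomial with every narrow block (precision `plo`) replaced by its Theorem-P bound `B_{b_i}`. -/
def outerLB (ulo v : ℚ) : DTree → ℚ
  | blk b => optB ulo (nleaves b)
  | node l r => comb v (outerLB ulo v l) (outerLB ulo v r)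

/-- The same design shape with one block `s` everywhere. -/
def uniform (s : PTree) : DTree → DTree
  | blk _ => blk s
  | node l r => node (uniform s l) (uniform s r)

/-- The design polynomial is the weighted outer polynomial with `v = u_phi`. -/
theorem treeMP_toPTree (u : ℕ → ℚ) (phi : ℕ) : ∀ d : DTree, treeMP u (toPTree phi d) = outerW u (u phi) d
  | blk _ => rfl
  | node l r => by simp [toPTree, outerW, comb, treeMP_toPTree u phi l, treeMP_toPTree u phi r]

/-- `shape` is invariant under `uniform`. -/
theorem shape_uniform (s : PTree) : ∀ d : DTree, shape (uniform s d) = shape d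
  | blk _ => rfl
  | node l r => by simp [shape, uniform, shape_uniform s l, shape_uniform s r]

/-- **Product formula (T5(c)).**  With the same block `s` at every leaf of the outer tree,
`M(design) = M_s · M_shape(u_phi)`. -/
theorem treeMP_uniform (u : ℕ → ℚ) (hu : ∀ p, 0 ≤ u p) (phi : ℕ) (s : PTree) :
    ∀ d : DTree, treeMP u (toPTree phi (uniform s d)) = treeMP u s * treeM (u phi) (shape d)
  | blk _ => by simp [uniform, toPTree, shape]
  | node l r => by
      have hs : 0 ≤ treeMP u s := le_of_lt (treeMP_pos hu s)
      simp only [uniform, toPTree, shape, treeMP_node, treeM_node, treeMP_uniform u hu phi s l,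
        treeMP_uniform u hu phi s r]
      have := comb_mul (v := u phi) (x := treeM (u phi) (shape l)) (y := treeM (u phi) (shape r)) hs
      unfold comb at this
      linarith [this]

/-- **Pairwise blocks are optimal inside any outer tree.**  If every block is a narrow block (all its
additions at precision `plo`, `0 ≤ u_lo ≤ 1`) and `0 ≤ v = u_phi`, then `outerLB ≤ M(design)`. -/
theorem outerLB_le (u : ℕ → ℚ) {plo phi : ℕ} (hlo0 : 0 ≤ u plo) (hlo1 : u plo ≤ 1) (hphi : 0 ≤ u phi) :
    ∀ d : DTree, Blocks (AllLabels plo) d → outerLB (u plo) (u phi) d ≤ treeMP u (toPTree phi d)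
  | blk b, hb => by
      simp only [outerLB, toPTree, nleaves]
      rw [treeMP_allLabels u hb]
      exact optB_le_treeM hlo0 hlo1 (forget b)
  | node l r, h => by
      simp only [outerLB, toPTree, treeMP_node]
      have := comb_mono hphi (outerLB_le u hlo0 hlo1 hphi l h.1) (outerLB_le u hlo0 hlo1 hphi r h.2)
      unfold comb at this
      exact this

/-- With equal block sizes `b`, `outerLB = B_b(u_lo) · M_shape(v)`. -/
theorem outerLB_equal (ulo v : ℚ) {b : ℕ} (hB : 0 ≤ optB ulo b) :
    ∀ d : DTree, Blocks (fun t => nleaves t = b) d → outerLB ulo v d = optB ulo b * treeM v (shape d)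
  | blk t, h => by simp only [outerLB, shape, treeM_leaf, mul_one]; rw [show nleaves t = b from h]
  | node l r, h => by
      simp only [outerLB, shape, treeM_node]
      rw [outerLB_equal ulo v hB l h.1, outerLB_equal ulo v hB r h.2]
      exact comb_mul (v := v) (x := treeM v (shape l)) (y := treeM v (shape r)) hB

/-- **T5(d), lower bound.**  Every two-level design with `m` narrow blocks (precision `plo`) of `b`
summands each and wide additions at precision `phi` (`0 ≤ u_lo, u_phi ≤ 1`) has
`M ≥ B_b(u_lo) · B_m(u_phi)`. -/
theorem product_lower_bound (u : ℕ → ℚ) {plo phi : ℕ} (hlo0 : 0 ≤ u plo) (hlo1 : u plo ≤ 1)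
    (hphi0 : 0 ≤ u phi) (hphi1 : u phi ≤ 1) {b : ℕ} (d : DTree)
    (hlab : Blocks (AllLabels plo) d) (hsize : Blocks (fun t => nleaves t = b) d) :
    optB (u plo) b * optB (u phi) (nblocks d) ≤ treeMP u (toPTree phi d) := by
  have hB : 0 ≤ optB (u plo) b := optB_nonneg hlo0 b
  calc optB (u plo) b * optB (u phi) (nblocks d)
      ≤ optB (u plo) b * treeM (u phi) (shape d) :=
        mul_le_mul_of_nonneg_left (optB_le_treeM hphi0 hphi1 (shape d)) hB
    _ = outerLB (u plo) (u phi) d := (outerLB_equal (u plo) (u phi) hB d hsize).symm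
    _ ≤ treeMP u (toPTree phi d) := outerLB_le u hlo0 hlo1 hphi0 d hlab

/-- Design from an outer plain shape with the block `s` at every leaf. -/
def ofShape (s : PTree) : SumTree → DTree
  | .leaf _ => blk s
  | .node l r => node (ofShape s l) (ofShape s r)

/-- `shape (ofShape s o) = o` up to leaf values: same tree polynomial. -/
theorem treeM_shape_ofShape (v : ℚ) (s : PTree) : ∀ o : SumTree, treeM v (shape (ofShape s o)) = treeM v o
  | .leaf _ => rfl
  | .node l r => by simp [shape, ofShape, treeM, treeM_shape_ofShape v s l, treeM_shape_ofShape v s r]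

/-- `ofShape s o` is `uniform s` of itself. -/
theorem uniform_ofShape (s : PTree) : ∀ o : SumTree, uniform s (ofShape s o) = ofShape s o
  | .leaf _ => rfl
  | .node l r => by simp [uniform, ofShape, uniform_ofShape s l, uniform_ofShape s r]

/-- Number of blocks of `ofShape s o` = number of leaves of `o`. -/
theorem nblocks_ofShape (s : PTree) : ∀ o : SumTree, nblocks (ofShape s o) = (SumTree.leaves o).length
  | .leaf _ => rfl
  | .node l r => by
      have hl := nblocks_ofShape s l; have hr := nblocks_ofShape s r
      simp only [nblocks, shape, ofShape, SumTree.leaves, List.length_append] at hl hr ⊢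
      rw [hl, hr]

/-- The blocks of `ofShape s o` all equal `s`. -/
theorem blocks_ofShape {Q : PTree → Prop} (s : PTree) (hs : Q s) : ∀ o : SumTree, Blocks Q (ofShape s o)
  | .leaf _ => hs
  | .node l r => ⟨blocks_ofShape s hs l, blocks_ofShape s hs r⟩

/-- The PAIRWISE∘PAIRWISE design: pairwise outer tree on `m` blocks, each the pairwise tree on `b`
summands at precision `plo`. -/
def pairwiseDesign (plo b m : ℕ) : DTree := ofShape (ofSum plo (pw b)) (pw m)

/-- **T5(d), attainment.**  The pairwise∘pairwise design has `M = B_b(u_lo) · B_m(u_phi)`, `m` blocks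
of `b` summands, all narrow. -/
theorem pairwise_design_attains (u : ℕ → ℚ) (hu : ∀ p, 0 ≤ u p) (plo phi : ℕ) {b m : ℕ}
    (hb : 1 ≤ b) (hm : 1 ≤ m) :
    treeMP u (toPTree phi (pairwiseDesign plo b m)) = optB (u plo) b * optB (u phi) m ∧
    nblocks (pairwiseDesign plo b m) = m ∧ Blocks (AllLabels plo) (pairwiseDesign plo b m) ∧
    Blocks (fun t => nleaves t = b) (pairwiseDesign plo b m) := by
  refine ⟨?_, ?_, blocks_ofShape _ (allLabels_ofSum plo (pw b)) _, blocks_ofShape _ ?_ _⟩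
  · unfold pairwiseDesign
    rw [← uniform_ofShape, treeMP_uniform u hu, treeM_shape_ofShape, treeMP_ofSum, treeM_pw (hu plo) b hb,
      treeM_pw (hu phi) m hm]
  · unfold pairwiseDesign; rw [nblocks_ofShape, length_leaves_pw m hm]
  · rw [nleaves_ofSum, length_leaves_pw b hb]

/-- Designs whose blocks are well formed and fit below precision `phi` are well formed (so Theorem
U-mixed applies to them). -/
theorem WF_toPTree (P : ℕ → ℚ → Prop) (phi : ℕ) :
    ∀ d : DTree, Blocks (fun b => WF P b ∧ RootOK P phi b) d →
      WF P (toPTree phi d) ∧ RootOK P phi (toPTree phi d)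
  | blk _, h => h
  | node l r, h => by
      obtain ⟨wl, rl⟩ := WF_toPTree P phi l h.1
      obtain ⟨wr, rr⟩ := WF_toPTree P phi r h.2
      exact ⟨(wf_node P phi _ _).mpr ⟨rl, rr, wl, wr⟩, (rootOK_node P phi phi _ _).mpr le_rfl⟩

end DTree

/-! ## Statement-level summary -/

open DTree in
/-- R4 (Opt, CM-B exact, Theorem T5(c,d)): TWO-LEVEL DESIGNS.  With node weights `u_p = 2^-p`:
(c) product formula — a design with the same block `s` at every leaf of its outer tree has
`M = M_s · M_outer(u_phi)`; (d) among all two-level designs with `m ≥ 1` narrow blocks (precision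
`plo`) of `b ≥ 1` summands each and wide additions at precision `phi`, `M ≥ B_b(u_lo) · B_m(u_phi)`
(`optB`), and the pairwise∘pairwise design attains it; more generally pairwise blocks are optimal inside
any outer tree (`outerLB ≤ M`).  With `R4_MixedTreePolyUnderestimation` / `R4_MixedTreePolySharp`:
blocked summation of `n = b·m` nonnegative numbers with `m - 1` wide additions has worst-case relative
under-estimation at least `1 - 1/(B_b(u_lo) B_m(u_phi))` under round-to-nearest-even, with equality
for pairwise∘pairwise. -/
def R4_TwoLevelPairwiseOptimal : Prop :=
  (∀ (phi : ℕ) (s : PTree) (d : DTree),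
      treeMP (fun p => unitRoundoff p) (toPTree phi (uniform s d))
        = treeMP (fun p => unitRoundoff p) s * treeM (unitRoundoff phi) (shape d)) ∧
  (∀ (plo phi : ℕ) (d : DTree), Blocks (AllLabels plo) d →
      outerLB (unitRoundoff plo) (unitRoundoff phi) d ≤ treeMP (fun p => unitRoundoff p) (toPTree phi d)) ∧
  (∀ (plo phi b : ℕ) (d : DTree), Blocks (AllLabels plo) d → Blocks (fun t => nleaves t = b) d →
      optB (unitRoundoff plo) b * optB (unitRoundoff phi) (nblocks d)
        ≤ treeMP (fun p => unitRoundoff p) (toPTree phi d)) ∧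
  (∀ (plo phi b m : ℕ), 1 ≤ b → 1 ≤ m →
      treeMP (fun p => unitRoundoff p) (toPTree phi (pairwiseDesign plo b m))
        = optB (unitRoundoff plo) b * optB (unitRoundoff phi) m ∧
      nblocks (pairwiseDesign plo b m) = m ∧ Blocks (AllLabels plo) (pairwiseDesign plo b m) ∧
      Blocks (fun t => nleaves t = b) (pairwiseDesign plo b m))

open DTree in
/-- `R4_TwoLevelPairwiseOptimal` holds. -/
theorem R4_TwoLevelPairwiseOptimal_holds : R4_TwoLevelPairwiseOptimal :=
  ⟨fun phi s d => treeMP_uniform _ (fun p => unitRoundoff_nonneg p) phi s d,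
   fun plo phi d h => outerLB_le _ (unitRoundoff_nonneg plo) (unitRoundoff_le_one plo)
     (unitRoundoff_nonneg phi) d h,
   fun plo phi _ d hl hs => product_lower_bound _ (unitRoundoff_nonneg plo) (unitRoundoff_le_one plo)
     (unitRoundoff_nonneg phi) (unitRoundoff_le_one phi) d hl hs,
   fun plo phi _ _ hb hm => pairwise_design_attains _ (fun p => unitRoundoff_nonneg p) plo phi hb hm⟩

end Summit.Ventures.CertifiedArithmetic.LowPrec.Opt
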